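import Summits.Ventures.HodgeRepro.Tier3WedgeRestrictScalars

/-!
# The `K`-structure of the Weil line IS the `K`-structure of `∧^n_K V` — `q ∘ act(a) = a • q`, and
`∧^n_K V = K · q(w₀)` for any generator `w₀` of the Weil line

Blind re-derivation cell `pub-hodge-repro`, seat `t3-p4` (Tier 3, T3.5 for T3.4 = Lemma R).  Target tree path
`lean/Summits/Ventures/HodgeRepro/Tier3WeilLineScalars.lean`; imports the cell's `Tier3WedgeRestrictScalars`.

WHAT THIS FILE STATES (LEMMA-R-RESIDUE.md §4(d), read through the restriction-of-scalars map `q` of §4(b) / v14 §18).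
§4(d) makes the Weil line `W_F(B)` an `F`-vector space through `act(a) := ι_1(a)^* ⊗ id ⊗ ⋯ ⊗ id` (the first corner's
multiplication by `a`) and finds `dim_F W_F(B) = 1`.  On the kernel, `act(a)` is `⋀^{2k}(A′ b)` with
`b = (a at i₀, 1 elsewhere)`, `A′ b = (ω′_i ↦ b_i • ω′_i)` the diagonal operator of the basis `ω′`.  This file shows that
through `q : ⋀[F₀]^n V → ⋀[K]^n V` (`v₁ ∧_{F₀} ⋯ ∧ vₙ ↦ v₁ ∧_K ⋯ ∧ vₙ`, `n = |ι| = dim_K V`) the `F`-structure of §4(d)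
IS the natural `K`-structure of the top exterior power `⋀[K]^n V`:

* `map_diag_eq_prod_smul` — on the TOP exterior power `⋀[K]^n V` (`n = |ι|`), `⋀^n(A′ b)` is the scalar `∏_i b_i`
  (the determinant of the diagonal operator; `AlternatingMap.map_smul_univ` on the one wedge basis vector, and
  `Module.Basis.ext` on the basis `ω′.exteriorPower n`);
* `restrictScalars_map_diag` — `q (⋀^n_{F₀}(A′ b) v) = (∏_i b_i) • q v` for every `v ∈ ⋀[F₀]^n V`
  (`exteriorPower.linearMap_ext` on the wedges);
* `restrictScalars_map_update` — `q (act(a) v) = a • q v`: the first corner's multiplication by `a` becomes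
  multiplication by `a` on `⋀[K]^n V` (`∏_i (a at i₀, 1 elsewhere)_i = a`);
* `scalars_of_weil_line_generator` — given `q` injective on `W_F` and `W_F` onto `⋀[K]^n V`
  (`Tier3WeilLineRestriction.weil_line_restrictScalars` (4)–(5)) and a generator `w₀ ≠ 0` of `W_F` under `act`
  (`Tier3LemmaRGenerator.exists_weil_line_generator`'s `w₀ = e₀ (⋀^{2k} M η)`, or any non-zero `w ∈ W_F` by
  `Tier3LemmaRCorrespondence`'s rank-one clause): `q w₀ ≠ 0` and EVERY `y ∈ ⋀[K]^n V` is `a • q w₀` for exactly one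
  `a ∈ K` — «`∧^{2p}_F H¹(B, ℚ) = F · q(e · m^* η)`», the Weil line of LEMMA R inside `∧^{2p}_F H¹(B, ℚ)` is the
  `F`-line through the image of its generator.

Read with `V = H¹(B, ℚ)`, `K = F`, `F₀ = ℚ`, `n = 2p`: §4(d)'s «`W_F(B)` is a one-dimensional `F`-vector space under
`act`» is, through Deligne's identification `q|_{W_F} : W_F ≅ ∧^{2p}_F H¹(B, ℚ)`, the tautology that `∧^{2p}_F H¹` is
one-dimensional over `F` — and `act(a)` corresponds to the scalar `a`.  Nothing mathematical moves (LEMMA-R-RESIDUE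
v14: residue 0 unchanged); these are elementary untwinned sentences of §4(d) on the kernel.

HONESTY.  Linear algebra on the cell's own modules and Mathlib; no definition is introduced; nothing geometric is built.
HC_CM is NOT proved by anyone in this repository.
-/

set_option autoImplicit false

open TensorProduct Finset

namespace HodgeRepro.Tier3

open HodgeRepro.RouteC

section Scalars

variable {F₀ K : Type*} [Field F₀] [Field K] [Algebra F₀ K]
variable {V : Type*} [AddCommGroup V] [Module K V] [Module F₀ V] [IsScalarTower F₀ K V]
variable {ι : Type*} [Fintype ι] [LinearOrder ι]

/-- **The top exterior power of a diagonal operator is the product of its diagonal.**  For a `K`-basis `ω′ : ι → V`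
with `|ι| = n`, the diagonal operator `A′ b` (`ω′_i ↦ b_i • ω′_i`) acts on `⋀[K]^n V` as the scalar `∏_i b_i`. -/
theorem map_diag_eq_prod_smul {n : ℕ} (hn : Fintype.card ι = n) (ω' : Module.Basis ι K V)
    (A' : (ι → K) → V →ₗ[K] V) (hA' : ∀ (b : ι → K) (i : ι), A' b (ω' i) = b i • ω' i)
    (b : ι → K) (z : ⋀[K]^n V) :
    exteriorPower.map n (A' b) z = (∏ i, b i) • z := by
  classical
  -- on the wedge basis vector(s): an `n`-subset of `ι` is `univ`, enumerated by a bijection `Fin n ≃ ι`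
  have key : ∀ s : Set.powersetCard ι n,
      exteriorPower.map n (A' b) (exteriorPower.ιMulti_family K n ω' s) =
        (∏ i, b i) • exteriorPower.ιMulti_family K n ω' s := by
    intro s
    rw [exteriorPower.map_apply_ιMulti_family, exteriorPower.ιMulti_family, exteriorPower.ιMulti_family]
    have hcomp : (A' b ∘ ω') ∘ (Set.powersetCard.ofFinEmbEquiv.symm s) =
        fun j => b (Set.powersetCard.ofFinEmbEquiv.symm s j) • (ω' ∘ Set.powersetCard.ofFinEmbEquiv.symm s) j := by
      funext j
      simp only [Function.comp_apply, hA']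
    rw [hcomp, AlternatingMap.map_smul_univ]
    congr 1
    -- the enumeration is a bijection `Fin n ≃ ι`
    have hsurj : Function.Surjective (Set.powersetCard.ofFinEmbEquiv.symm s) := by
      intro i
      have hs : (s : Finset ι) = Finset.univ :=
        Finset.eq_univ_of_card _ ((Set.powersetCard.mem_iff.mp s.2).trans hn.symm)
      have hi : i ∈ s := by
        rw [← Set.powersetCard.mem_coe_iff, hs]
        exact Finset.mem_univ i
      exact (Set.powersetCard.mem_range_ofFinEmbEquiv_symm_iff_mem s i).mpr hi
    let e : Fin n ≃ ι :=
      Equiv.ofBijective (Set.powersetCard.ofFinEmbEquiv.symm s) ⟨(Set.powersetCard.ofFinEmbEquiv.symm s).injective, hsurj⟩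
    exact Fintype.prod_equiv e (fun j => b (Set.powersetCard.ofFinEmbEquiv.symm s j)) b (fun _ => rfl)
  -- the two `K`-linear maps agree on the basis `ω′.exteriorPower n`
  have hmaps : exteriorPower.map n (A' b) = (∏ i, b i) • (LinearMap.id : ⋀[K]^n V →ₗ[K] ⋀[K]^n V) := by
    refine Module.Basis.ext (ω'.exteriorPower n) fun s => ?_
    rw [exteriorPower.basis_apply, key s, LinearMap.smul_apply, LinearMap.id_apply]
  rw [hmaps, LinearMap.smul_apply, LinearMap.id_apply]

/-- **`q` intertwines the diagonal operators with their determinants.**  For the restriction-of-scalars map `q`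
(`Tier3WedgeRestrictScalars.exists_restrictScalars_wedge`) and the diagonal operator `A′ b` of a `K`-basis `ω′ : ι → V`,
`|ι| = n`: `q (⋀^n_{F₀}(A′ b) v) = (∏_i b_i) • q v`. -/
theorem restrictScalars_map_diag {n : ℕ} (hn : Fintype.card ι = n) (ω' : Module.Basis ι K V)
    (A' : (ι → K) → V →ₗ[K] V) (hA' : ∀ (b : ι → K) (i : ι), A' b (ω' i) = b i • ω' i)
    (q : ⋀[F₀]^n V →ₗ[F₀] ⋀[K]^n V)
    (hq : ∀ v : Fin n → V, q (exteriorPower.ιMulti F₀ n v) = exteriorPower.ιMulti K n v)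
    (b : ι → K) (v : ⋀[F₀]^n V) :
    q (exteriorPower.map n ((A' b).restrictScalars F₀) v) = (∏ i, b i) • q v := by
  -- both sides are `F₀`-linear in `v`; compare on the wedges
  have hmaps : q ∘ₗ exteriorPower.map n ((A' b).restrictScalars F₀) =
      (LinearMap.lsmul K (⋀[K]^n V) (∏ i, b i)).restrictScalars F₀ ∘ₗ q := by
    refine exteriorPower.linearMap_ext ?_
    ext w
    simp only [LinearMap.compAlternatingMap_apply, LinearMap.comp_apply, exteriorPower.map_apply_ιMulti,
      LinearMap.coe_restrictScalars, hq, LinearMap.lsmul_apply]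
    rw [← map_diag_eq_prod_smul hn ω' A' hA' b, exteriorPower.map_apply_ιMulti]
  have := LinearMap.congr_fun hmaps v
  simp only [LinearMap.comp_apply, LinearMap.coe_restrictScalars, LinearMap.lsmul_apply] at this
  exact this

/-- **The first corner's multiplication by `a` is the scalar `a` on `⋀[K]^n V`**: for `act(a) = ⋀^n(A′ (a at i₀, 1
elsewhere))` as written in `Tier3LemmaRGenerator` / `Tier3LemmaRCorrespondence`, `q (act(a) v) = a • q v`. -/
theorem restrictScalars_map_update {n : ℕ} (hn : Fintype.card ι = n) (ω' : Module.Basis ι K V)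
    (q : ⋀[F₀]^n V →ₗ[F₀] ⋀[K]^n V)
    (hq : ∀ v : Fin n → V, q (exteriorPower.ιMulti F₀ n v) = exteriorPower.ιMulti K n v)
    (i₀ : ι) (a : K) (v : ⋀[F₀]^n V) :
    q (exteriorPower.map n
        ((ω'.constr K fun i => Function.update (fun _ => (1 : K)) i₀ a i • ω' i).restrictScalars F₀) v) =
      a • q v := by
  classical
  have h := restrictScalars_map_diag (F₀ := F₀) hn ω' (fun b => ω'.constr K fun i => b i • ω' i)
    (fun b i => by rw [Module.Basis.constr_basis]) q hq (Function.update (fun _ => (1 : K)) i₀ a) v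
  rw [h, Finset.prod_update_of_mem (Finset.mem_univ i₀), Finset.prod_const_one, mul_one]

/-- **`∧^n_K V = K · q(w₀)` for a generator `w₀` of the Weil line.**  If `q` is injective on `W_F` and maps `W_F` onto
`⋀[K]^n V` (`Tier3WeilLineRestriction.weil_line_restrictScalars` (4)–(5)) and `w₀ ≠ 0` in `W_F` generates `W_F` under
`act(a)` (`Tier3LemmaRGenerator.exists_weil_line_generator`: `w₀ = e₀ (⋀^{2k} M η)`), then `q w₀ ≠ 0` and every
`y ∈ ⋀[K]^n V` is `a • q w₀` for exactly one `a ∈ K` — LEMMA R's Weil line inside `∧^{2p}_F H¹(B, ℚ)` is the `F`-line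
through `q(e · m^* η)`, and §4(d)'s `F`-structure `act` is the scalar multiplication of `∧^{2p}_F H¹(B, ℚ)`. -/
theorem scalars_of_weil_line_generator {n : ℕ} (hn : Fintype.card ι = n) (ω' : Module.Basis ι K V)
    (q : ⋀[F₀]^n V →ₗ[F₀] ⋀[K]^n V)
    (hq : ∀ v : Fin n → V, q (exteriorPower.ιMulti F₀ n v) = exteriorPower.ιMulti K n v)
    (WF : Submodule F₀ (⋀[F₀]^n V))
    (hinj : ∀ v ∈ WF, q v = 0 → v = 0) (honto : ∀ y : ⋀[K]^n V, ∃ v ∈ WF, q v = y)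
    (i₀ : ι) (w₀ : ⋀[F₀]^n V) (hw₀ : w₀ ∈ WF) (hw₀ne : w₀ ≠ 0)
    (hgen : ∀ x ∈ WF, ∃ a : K, x = exteriorPower.map n
      ((ω'.constr K fun i => Function.update (fun _ => (1 : K)) i₀ a i • ω' i).restrictScalars F₀) w₀) :
    q w₀ ≠ 0 ∧ ∀ y : ⋀[K]^n V, ∃! a : K, y = a • q w₀ := by
  have hq0 : q w₀ ≠ 0 := fun h => hw₀ne (hinj w₀ hw₀ h)
  refine ⟨hq0, fun y => ?_⟩
  obtain ⟨x, hxW, hxy⟩ := honto y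
  obtain ⟨a, hxa⟩ := hgen x hxW
  refine ⟨a, ?_, fun a' ha' => ?_⟩
  · rw [← hxy, hxa, restrictScalars_map_update hn ω' q hq i₀ a w₀]
  · have h1 : a' • q w₀ = a • q w₀ := by
      rw [← ha', ← hxy, hxa, restrictScalars_map_update hn ω' q hq i₀ a w₀]
    have h2 : (a' - a) • q w₀ = 0 := by
      have h3 := sub_smul a' a (q w₀)
      rw [h3, h1, sub_self]
    exact sub_eq_zero.mp ((smul_eq_zero.mp h2).resolve_right hq0)

end Scalars

end HodgeRepro.Tier3
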